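import Literature.NumberTheory.Transcendental.ZilberFieldSaturationMain
import Literature.NumberTheory.Transcendental.EclExchangeProofs
import Literature.NumberTheory.Transcendental.DerivationExtension
import Literature.NumberTheory.Transcendental.AxSchanuelProofs
import Literature.NumberTheory.Transcendental.GammaKummerLevels
import HarnessLib

/-!
# Exponentially algebraic elements are Γ-algebraic: Khovanskii systems have predimension `≤ 0`

J. Kirby, *Exponential algebraicity in exponential fields*, Bull. Lond. Math. Soc. 42 (2010)
879–890, Prop. 4.7, Lemma 4.8 and §7 (proof of Thm. 1.3), and M. Bays, J. Kirby, *Pseudo-exponential maps, variants, and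
quasiminimality*, Algebra & Number Theory 12 (2018), Remark 10.10 ("`ecl`-closed = `Γcl`-closed"):
the exponential-algebraic closure `ecl` (first coordinates of non-degenerate solutions of
Khovanskii systems, Kirby Def. 3.1–3.2, the tree's `Literature.NumberTheory.Transcendental.ecl`)
is contained in the closure defined from the predimension
`δ(x̄/Λ) = td(x̄, exp x̄/Λ) - ldim_ℚ(x̄/Λ)` (`GammaField.predim`): a solution `x̄` of a Khovanskii
system whose coefficients lie in the Γ-field `ℚ(Λ, exp Λ)` of a `ℚ`-subspace `Λ` satisfies
`δ(x̄/Λ) ≤ 0`.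

The tree proves the opposite inclusion in several forms (Kirby's Thm. 1.2, `δ ≥ dim`:
`card_succ_le_relTrdeg_of_isEclClosed`, `GammaField.isGammaClosed_span_ecl_univ`,
`ZilberFieldHomogeneityProofs.lean`); this file supplies the inclusion `ecl ⊆ Γcl`, which is what
makes a back-and-forth between `ecl`-closures stay inside the closures (Kirby 2010, *On
quasiminimal excellent classes*, Thm 2.1, for Zilber fields:
`IsZilberField.eclIso_extension`, `ZilberFieldQuasiminimal.lean`).

* `GammaField.trdeg_adjoin_le_of_khovanskii` — **the transcendence bound**: if `x̄ ∈ Fⁿ` solves a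
  Khovanskii system with coefficients in `L = ℚ(Λ, exp Λ)` and `x̄ ⊆ Λ + ℚ(x ∘ ρ)` for a
  sub-tuple `x ∘ ρ` of length `k`, then `trdeg_L L(x̄, exp x̄) ≤ k`. Proof (Kirby 2010, proof of
  Lemma 4.8/Prop. 4.7, dualised): an `L`-derivation `D` of `M = L(x̄, exp x̄)` is determined by its
  *exponential defects* `D(e^{x_{ρ s}}) - e^{x_{ρ s}} D(x_{ρ s})`, `s < k` — if they vanish, the
  `ℚ`-linear relations of `x̄` modulo `Λ` (and their exponentials) make `D` exponential on all of
  `x̄`, the chain rule through the system (`derivation_apply_eq_zero_of_khovanskii`, applied to an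
  extension of `D` to `F`, `Derivation.exists_extension_of_charZero`) kills `x̄` and `exp x̄`, so
  `D = 0`; hence `dim_M Der_L(M) ≤ k`, and `trdeg_L M ≤ dim_M Der_L(M)`
  (`trdeg_le_finrank_derivation`).
* `GammaField.predim_span_le_zero_of_khovanskii` — hence `δ(x̄/Λ) ≤ 0`
  (`td ≤ k = ldim`, through the bridge `toENat_trdeg_adjoin_eq_relRank`).
* `GammaField.exists_predim_le_zero_of_mem_ecl` — every `d ∈ ecl C`, `C ⊆ ℚ(Λ, exp Λ)`, lies in
  a finite tuple `x̄` with `δ(x̄/Λ) ≤ 0`; `GammaField.exists_predim_le_zero_of_mem_ecl_coe` — the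
  case `C = Λ`.

Everything here is proved; nothing is specific to Zilber fields (any exponential field of
characteristic zero).

## References

* J. Kirby, *Exponential algebraicity in exponential fields*, Bull. Lond. Math. Soc. 42 (2010),
  879–890, arXiv:0810.4285: Def. 3.1–3.2, Prop. 4.7, Lemma 4.8, Thm. 1.3.
* M. Bays, J. Kirby, *Pseudo-exponential maps, variants, and quasiminimality*, Algebra & Number
  Theory 12 (2018) 493–549: Def. 4.1 (predimension), Remark 10.10.
-/

noncomputable section

open Set MvPolynomial

universe u

namespace Literature.NumberTheory.Transcendental

namespace GammaField

open Literature.ModelTheory.ExponentialFields Literature.ModelTheory.ExponentialFields.ExponentialRing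
  ZilberSaturationMain

variable {F : Type u} [Field F] [CharZero F] [ExponentialRing F]

/-! ### The transcendence bound for solutions of Khovanskii systems -/

section TrdegBound

variable (Λ : Submodule ℚ F) {S : Set F} {n : ℕ} {x : Fin n → F}
  {f : Fin n → MvPolynomial (Fin n ⊕ Fin n) F}

/-- `exp (m • b) ∈ ℚ(Λ, exp Λ)` for `b ∈ Λ`. [folklore] -/
theorem exp_natCast_mul_mem_fieldOf {b : F} (hb : b ∈ Λ) (m : ℕ) :
    exp ((m : F) * b) ∈ fieldOf Λ := by
  refine exp_mem_fieldOf ?_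
  rw [show (m : F) * b = (m : ℚ) • b by rw [Nat.cast_smul_eq_nsmul, nsmul_eq_mul]]
  exact Λ.smul_mem _ hb

set_option maxHeartbeats 800000 in
/-- **The transcendence bound for Khovanskii systems** (Kirby 2010, proof of Prop. 4.7 /
Lemma 4.8, in dual form). Let `Λ ≤ F` be a `ℚ`-subspace with Γ-field `L = ℚ(Λ, exp Λ)`
(`GammaField.fieldOf`), and let `x̄ ∈ Fⁿ` be a non-degenerate solution of a Khovanskii system
`fᵢ(x̄, e^{x̄}) = 0` (`i < n`) whose coefficients lie in the subring generated by `S ⊆ L`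
(non-vanishing exponential Jacobian `det(∂fᵢ/∂Xⱼ + Yⱼ ∂fᵢ/∂Yⱼ)(x̄, e^{x̄})`). If every `xⱼ`
lies in `Λ + ℚ·{x_{ρ s} : s < k}` for a sub-tuple `x ∘ ρ`, then
`trdeg_L L(x̄, e^{x̄}) ≤ k`: the `M`-linear map sending an `L`-derivation `D` of
`M = L(x̄, e^{x̄})` to its exponential defects `(D e^{x_{ρ s}} - e^{x_{ρ s}} D x_{ρ s})_{s < k}`
is injective (vanishing defects propagate along the `ℚ`-linear relations modulo `Λ`, then the
chain rule through the system forces `D x̄ = 0`), and `trdeg_L M ≤ dim_M Der_L(M)`.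
[cite: Kirby2010, Prop. 4.7, Lemma 4.8 and §7 (proof of Thm. 1.3)] -/
theorem trdeg_adjoin_le_of_khovanskii (hS : S ⊆ (fieldOf Λ : Set F))
    (hcoeff : ∀ i m, (f i).coeff m ∈ Subring.closure S)
    (heval : ∀ i, eval (Sum.elim x (exp ∘ x)) (f i) = 0)
    (hdet : (Matrix.of fun i j => eval (Sum.elim x (exp ∘ x)) (expPDeriv j (f i))).det ≠ 0)
    {k : ℕ} {ρ : Fin k → Fin n}
    (hspan : ∀ j, x j ∈ Λ ⊔ Submodule.span ℚ (range (x ∘ ρ))) :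
    Algebra.trdeg (fieldOf Λ)
        (IntermediateField.adjoin (fieldOf Λ) (range (Sum.elim x (exp ∘ x)))) ≤ k := by
  classical
  set L : IntermediateField ℚ F := fieldOf Λ with hL
  set z : Fin n ⊕ Fin n → F := Sum.elim x (exp ∘ x) with hz
  set M : IntermediateField L F := IntermediateField.adjoin L (range z) with hM
  haveI : CharZero L := charZero_of_injective_algebraMap (algebraMap ℚ L).injective
  haveI : CharZero M := charZero_of_injective_algebraMap (algebraMap ℚ M).injective
  -- the generators inside `M`
  let zM : Fin n ⊕ Fin n → M := fun s => ⟨z s, IntermediateField.subset_adjoin L _ ⟨s, rfl⟩⟩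
  let xM : Fin n → M := fun j => zM (Sum.inl j)
  let yM : Fin n → M := fun j => zM (Sum.inr j)
  have hxM : ∀ j, ((xM j : M) : F) = x j := fun j => rfl
  have hyM : ∀ j, ((yM j : M) : F) = exp (x j) := fun j => rfl
  have hy0 : ∀ j, yM j ≠ 0 := fun j h => exp_ne_zero (x j) (by rw [← hyM j, h]; rfl)
  have hamap : ∀ y : L, ((algebraMap L M y : M) : F) = (y : F) := fun _ => rfl
  -- the defect map
  let Φ : Derivation L M M →ₗ[M] (Fin k → M) :=
    { toFun := fun D s => D (yM (ρ s)) - yM (ρ s) * D (xM (ρ s))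
      map_add' := fun D₁ D₂ => by
        funext s
        simp only [Derivation.coe_add, Pi.add_apply]
        ring
      map_smul' := fun a D => by
        funext s
        simp only [Derivation.coe_smul, Pi.smul_apply, smul_eq_mul, RingHom.id_apply]
        ring }
  have hΦ : ∀ D s, Φ D s = D (yM (ρ s)) - yM (ρ s) * D (xM (ρ s)) := fun _ _ => rfl
  -- vanishing defects on `x ∘ ρ` propagate to all of `x̄`
  have key : ∀ D : Derivation L M M, Φ D = 0 → ∀ j, D (yM j) = yM j * D (xM j) := by
    intro D hD j
    have hDρ : ∀ s, D (yM (ρ s)) = yM (ρ s) * D (xM (ρ s)) := fun s => by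
      have := congrFun hD s
      rw [hΦ, Pi.zero_apply, sub_eq_zero] at this
      exact this
    -- the relation `m xⱼ = m b + Σ vₛ x_{ρ s}`, `b ∈ Λ`, `vₛ ∈ ℤ`, `m ≥ 1`
    obtain ⟨b, hb, w, hw, hsum⟩ := Submodule.mem_sup.1 (hspan j)
    obtain ⟨q, rfl⟩ := (Submodule.mem_span_range_iff_exists_fun ℚ).1 hw
    obtain ⟨m, hm, v, hv⟩ := exists_common_den q
    have haddF : (m : F) * x j = (m : F) * b + ∑ s, (v s : F) * x (ρ s) := by
      rw [← hsum, mul_add, Finset.mul_sum]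
      congr 1
      refine Finset.sum_congr rfl fun s _ => ?_
      rw [Function.comp_apply, Rat.smul_def, ← mul_assoc, ← Rat.cast_natCast, ← Rat.cast_mul, hv s,
        Rat.cast_intCast]
    have hbL : (m : F) * b ∈ L := by
      refine mem_fieldOf_of_mem ?_
      rw [show (m : F) * b = (m : ℚ) • b by rw [Nat.cast_smul_eq_nsmul, nsmul_eq_mul]]
      exact Λ.smul_mem _ hb
    have hcL : exp ((m : F) * b) ∈ L := exp_natCast_mul_mem_fieldOf Λ hb m
    -- additive relation in `M` and its derivative
    have haddM : (∑ s, (v s : M) * xM (ρ s)) = (m : M) * xM j - algebraMap L M ⟨(m : F) * b, hbL⟩ := by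
      rw [eq_sub_iff_add_eq]
      apply Subtype.ext
      simp only [AddMemClass.coe_add, MulMemClass.coe_mul, hamap]
      rw [AddSubmonoidClass.coe_finsetSum]
      simp only [MulMemClass.coe_mul]
      have e1 : ∀ s, (((v s : M) : M) : F) = (v s : F) := fun s => by simp
      have e2 : (((m : M) : M) : F) = (m : F) := by simp
      simp only [e1, e2, hxM]
      rw [haddF, add_comm]
    have hDadd : D (∑ s, (v s : M) * xM (ρ s)) = (m : M) * D (xM j) := by
      rw [haddM, map_sub, Derivation.map_algebraMap, sub_zero,
        show (m : M) * xM j = (m : ℕ) • xM j from (nsmul_eq_mul _ _).symm, map_nsmul, nsmul_eq_mul]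
    -- multiplicative relation in `M`
    have hmulF : exp (x j) ^ m = exp ((m : F) * b) * ∏ s, exp (x (ρ s)) ^ (v s) := by
      rw [← exp_nsmul, nsmul_eq_mul, haddF, exp_add, exp_sum_intCast_mul]
    have hmulM : yM j ^ m = algebraMap L M ⟨exp ((m : F) * b), hcL⟩ * ∏ s, yM (ρ s) ^ (v s) := by
      apply Subtype.ext
      rw [SubmonoidClass.coe_pow, MulMemClass.coe_mul, hamap, hyM, hmulF]
      congr 1
      rw [IntermediateField.coe_prod]
      refine Finset.prod_congr rfl fun s _ => ?_
      rw [← hyM (ρ s)]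
      exact (map_zpow₀ (algebraMap M F) (yM (ρ s)) (v s)).symm
    -- differentiate the multiplicative relation
    have hDprod : D (∏ s, yM (ρ s) ^ (v s)) =
        (∏ s, yM (ρ s) ^ (v s)) * D (∑ s, (v s : M) * xM (ρ s)) :=
      derivation_prod_zpow_of_exp D (fun s => xM (ρ s)) (fun s => yM (ρ s)) (fun s => hy0 (ρ s)) hDρ v
    have hD1 : D (yM j ^ m) = yM j ^ m * ((m : M) * D (xM j)) := by
      conv_lhs => rw [hmulM]
      rw [Derivation.leibniz, Derivation.map_algebraMap, smul_zero, add_zero, smul_eq_mul, hDprod,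
        ← mul_assoc, ← hmulM, hDadd]
    have hD2 : D (yM j ^ m) = (m : M) * yM j ^ (m - 1) * D (yM j) := by
      rw [Derivation.leibniz_pow, nsmul_eq_mul, smul_eq_mul, mul_assoc]
    -- cancel `m yⱼ^{m-1}`
    obtain ⟨m', rfl⟩ : ∃ m', m = m' + 1 := ⟨m - 1, (Nat.sub_add_cancel hm).symm⟩
    rw [hD2, Nat.add_sub_cancel, pow_succ] at hD1
    have hm0 : ((m' + 1 : ℕ) : M) ≠ 0 := Nat.cast_ne_zero.2 (Nat.succ_ne_zero m')
    have hp0 : yM j ^ m' ≠ 0 := pow_ne_zero _ (hy0 j)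
    have := hD1
    -- `(m) * y^{m'} * D y = y^{m'} * y * (m * D x)`
    have h' : ((m' + 1 : ℕ) : M) * yM j ^ m' * (D (yM j) - yM j * D (xM j)) = 0 := by
      rw [mul_sub, this]; ring
    rcases mul_eq_zero.1 h' with h1 | h1
    · rcases mul_eq_zero.1 h1 with h2 | h2
      · exact absurd h2 hm0
      · exact absurd h2 hp0
    · exact sub_eq_zero.1 h1
  -- injectivity of the defect map
  have hinj : Function.Injective Φ := by
    refine (injective_iff_map_eq_zero Φ).2 fun D hD => ?_
    have hE := key D hD
    -- extend `D` to a derivation of `F`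
    let DF : Derivation L M F := (Algebra.linearMap M F).compDer D
    have hDF : ∀ s : M, DF s = ((D s : M) : F) := fun s => rfl
    obtain ⟨D', hD'⟩ := Derivation.exists_extension_of_charZero (R := L) (F := M) (T := F) (M := F) DF
    let D'' : Derivation ℤ F F := D'.restrictScalars ℤ
    have hD''x : ∀ j, D'' (x j) = ((D (xM j) : M) : F) := fun j => by
      show D' (algebraMap M F (xM j)) = _
      rw [hD', hDF]
    have hD''y : ∀ j, D'' (exp (x j)) = ((D (yM j) : M) : F) := fun j => by
      show D' (algebraMap M F (yM j)) = _
      rw [hD', hDF]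
    have hDS : ∀ s ∈ S, D'' s = 0 := fun s hs => by
      show D' s = 0
      have : s = algebraMap L F ⟨s, hS hs⟩ := rfl
      rw [this, Derivation.map_algebraMap]
    have hDE : ∀ j, D'' (exp (x j)) = exp (x j) * D'' (x j) := fun j => by
      rw [hD''y, hD''x, hE j, MulMemClass.coe_mul, hyM]
    have hx0 : ∀ j, D (xM j) = 0 := fun j => by
      have h := derivation_apply_eq_zero_of_khovanskii hcoeff heval hdet D'' hDS hDE j
      rw [hD''x] at h
      exact_mod_cast h
    have hy0' : ∀ j, D (yM j) = 0 := fun j => by rw [hE j, hx0 j, mul_zero]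
    refine derivation_eq_zero_of_adjoin_eq_top (F := L) D (fun c => D.map_algebraMap c)
      (S := ((↑) : M → F) ⁻¹' range z) (fun s hs => ?_)
      (Literature.NumberTheory.Transcendental.IntermediateField.adjoin_preimage_val_eq_top (F := L) (range z))
    obtain ⟨t, ht⟩ := hs
    have : s = zM t := Subtype.ext ht.symm
    rw [this]
    rcases t with j | j
    · exact hx0 j
    · exact hy0' j
  -- dimension count
  haveI : Module.Finite M (Derivation L M M) := Module.Finite.of_injective Φ hinj
  have h1 : Module.finrank M (Derivation L M M) ≤ k := by
    have := LinearMap.finrank_le_finrank_of_injective hinj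
    simpa using this
  calc Algebra.trdeg L M ≤ (Module.finrank M (Derivation L M M) : Cardinal) :=
        trdeg_le_finrank_derivation
    _ ≤ k := by exact_mod_cast h1

end TrdegBound

/-! ### Predimension `≤ 0` -/

section Predim

variable (Λ : Submodule ℚ F) {S : Set F} {n : ℕ} {x : Fin n → F}
  {f : Fin n → MvPolynomial (Fin n ⊕ Fin n) F}

omit [CharZero F] in
/-- The point `(x̄, exp x̄)` has range `x̄ ∪ exp x̄`. [folklore] -/
theorem range_sumElim_exp (x : Fin n → F) :
    range (Sum.elim x (exp ∘ x)) = range x ∪ exp '' range x := by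
  rw [Set.Sum.elim_range, Set.range_comp]

/-- **Khovanskii systems have predimension `≤ 0`** (Kirby 2010, Thm. 1.3 / Bays–Kirby 2018,
Remark 10.10, direction `ecl ⊆ Γcl`): if `x̄` is a non-degenerate solution of a Khovanskii system
with coefficients in the subring generated by `S ⊆ ℚ(Λ, exp Λ)`, then
`δ(x̄/Λ) = td(x̄, exp x̄/Λ) - ldim_ℚ(x̄/Λ) ≤ 0` (`GammaField.predim`). Proof: with `x ∘ ρ` a basis
of `x̄` modulo `Λ` (`k` elements), `td ≤ trdeg_L L(x̄, e^{x̄}) ≤ k`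
(`trdeg_adjoin_le_of_khovanskii`) and `ldim = k`.
[cite: Kirby2010, Lemma 4.8 and §7 (proof of Thm. 1.3)] [cite: BaysKirby2018ANT, Remark 10.10] -/
theorem predim_span_le_zero_of_khovanskii (hS : S ⊆ (fieldOf Λ : Set F))
    (hcoeff : ∀ i m, (f i).coeff m ∈ Subring.closure S)
    (heval : ∀ i, eval (Sum.elim x (exp ∘ x)) (f i) = 0)
    (hdet : (Matrix.of fun i j => eval (Sum.elim x (exp ∘ x)) (expPDeriv j (f i))).det ≠ 0) :
    predim Λ (Submodule.span ℚ (range x)) ≤ 0 := by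
  classical
  obtain ⟨k, ρ, hind, hspanEq⟩ := exists_linIndepOver_comp Λ x
  have hspan : ∀ j, x j ∈ Λ ⊔ Submodule.span ℚ (range (x ∘ ρ)) := fun j => by
    rw [hspanEq]
    exact Submodule.mem_sup_right (Submodule.subset_span ⟨j, rfl⟩)
  -- `ldim = k`
  have hldim : ldim Λ (Submodule.span ℚ (range x)) = k := by
    rw [← ldim_sup_left, ← hspanEq, ldim_sup_left, ldim_span_eq_of_linIndepOver hind]
  -- `td ≤ k`
  have htr := trdeg_adjoin_le_of_khovanskii Λ hS hcoeff heval hdet hspan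
  have htd : td Λ (Submodule.span ℚ (range x)) ≤ k := by
    refine (td_span_le_relRank Λ (range x)).trans ?_
    rw [← range_sumElim_exp,
      (algMatroid F).relRank_congr_closure_left (range (Sum.elim x (exp ∘ x)))
        (show (algMatroid F).closure (gens Λ) = (algMatroid F).closure ((fieldOf Λ : Set F))
          from (acl_fieldOf Λ).symm),
      ← toENat_trdeg_adjoin_eq_relRank]
    have := (OrderHomClass.mono Cardinal.toENat htr)
    simpa using this
  have hfg : IsFG Λ (Submodule.span ℚ (range x)) := isFG_span_of_finite Λ (finite_range x)
  have htdnat : (td Λ (Submodule.span ℚ (range x))).toNat ≤ k := by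
    have hne := td_ne_top hfg
    rw [← ENat.coe_toNat hne] at htd
    exact_mod_cast htd
  rw [predim_def, hldim]
  omega

/-- **Exponentially algebraic elements are Γ-algebraic** (Kirby 2010, Thm. 1.3; Bays–Kirby
2018, Remark 10.10): if `d ∈ ecl C` with `C ⊆ ℚ(Λ, exp Λ)`, then `d` is a coordinate of a finite
tuple `x̄` with `δ(x̄/Λ) ≤ 0` — namely the solution of a Khovanskii system over `C` witnessing
`d ∈ ecl C`. [cite: Kirby2010, Prop. 7.1 and Lemma 4.8] [cite: BaysKirby2018ANT, Remark 10.10] -/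
theorem exists_predim_le_zero_of_mem_ecl {C : Set F} (hC : C ⊆ (fieldOf Λ : Set F)) {d : F}
    (hd : d ∈ ecl C) :
    ∃ (n : ℕ) (x : Fin n → F), d ∈ range x ∧ predim Λ (Submodule.span ℚ (range x)) ≤ 0 := by
  obtain ⟨n, x, f, ⟨i, hi⟩, hcoeff, heval, hdet⟩ := hd
  exact ⟨n, x, ⟨i, hi⟩, predim_span_le_zero_of_khovanskii Λ hC hcoeff heval hdet⟩

/-- The case `C = Λ` of `exists_predim_le_zero_of_mem_ecl`: every `d ∈ ecl Λ` lies in a finite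
tuple of predimension `≤ 0` over `Λ`. [cite: Kirby2010, Prop. 7.1 and Lemma 4.8] [cite: BaysKirby2018ANT, Remark 10.10] -/
theorem exists_predim_le_zero_of_mem_ecl_coe {d : F} (hd : d ∈ ecl (Λ : Set F)) :
    ∃ (n : ℕ) (x : Fin n → F), d ∈ range x ∧ predim Λ (Submodule.span ℚ (range x)) ≤ 0 :=
  exists_predim_le_zero_of_mem_ecl Λ (fun _ hb => mem_fieldOf_of_mem hb) hd

/-- **No Γ-generic element of `ecl Λ` over a strong `Λ`**: if `Λ ◁ F` and `d ∈ ecl Λ`, then the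
minimal predimension of a finitely generated extension of `Λ` containing `d` is `0` — there is a
finitely generated `E ⊇ Λ + ℚd` with `δ(E/Λ) = 0` (the tuple of `exists_predim_le_zero_of_mem_ecl`
has `δ ≤ 0`, and `δ ≥ 0` by strongness). [cite: Kirby2010, §7 (proof of Thm. 1.3)] [cite: BaysKirby2018ANT, Remark 10.10 and Lemma 4.10] -/
theorem exists_predim_eq_zero_of_mem_ecl_of_isStrong {Λ : Submodule ℚ F} (hΛ : IsStrong Λ) {d : F}
    (hd : d ∈ ecl (Λ : Set F)) :
    ∃ E : Submodule ℚ F, Λ ⊔ Submodule.span ℚ {d} ≤ E ∧ IsFG Λ E ∧ predim Λ E = 0 := by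
  obtain ⟨n, x, ⟨i, hi⟩, hδ⟩ := exists_predim_le_zero_of_mem_ecl_coe Λ hd
  have hfg : IsFG Λ (Submodule.span ℚ (range x)) := isFG_span_of_finite Λ (finite_range x)
  refine ⟨Λ ⊔ Submodule.span ℚ (range x), sup_le le_sup_left ?_, isFG_sup_left.2 hfg, ?_⟩
  · rw [Submodule.span_singleton_le_iff_mem]
    exact Submodule.mem_sup_right (Submodule.subset_span ⟨i, hi⟩)
  · rw [predim_sup_left]
    exact le_antisymm hδ ((isStrong_iff.1 hΛ) _ hfg)

end Predim

end GammaField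

end Literature.NumberTheory.Transcendental
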